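import Summits.Ventures.HSemireg.ContractionSpanFactor
import Mathlib.LinearAlgebra.Projection
import HarnessLib

/-!
# Venture HSemireg — Künneth structure of the polyvector contraction span, II: the product formula
# `span(x₁ ∧ x₂) = S²(x₁)·x₂ + S¹(x₁)·S¹(x₂) + x₁·S²(x₂)` over a splitting `V = V₁ ⊕ V₂` (th-7's K_lin, degree ≤ 2,
# in the LITERAL contraction frame of `PerfectComplexRankDoor.lean`)

HONEST FRAMING. Pure linear algebra in the exterior algebra `Λ V`, continuing `ContractionSpanFactor.lean` (seat p4 of the
computation cell `pub-hsemireg`; statement sheet `theory/FORMULA-N-th7.md` §N.3 «THEOREM K_lin» and §N.5 «the p4-carrier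
bridge», theory seat 7). Nothing here is a claim about any variety and nothing here says that HC / HC_CM / HC_AV holds.
Everything is PROVED; no named fact.

SETTING. `V = V₁ ⊕ V₂` (`IsCompl V₁ V₂`), `Lᵢ ⊆ Vᵢ` («`H^{0,1}` of the factor»; on `X × X′`, `H¹ = H¹(X) ⊕ H¹(X′)` and
`H^{0,1} = H^{0,1}(X) ⊕ H^{0,1}(X′)`), factor forms `factorForms Lᵢ V_{3-i}` (killing `Lᵢ` and the other factor). For EVEN
factor classes `x₁ ∈ evenFactorAlg V₁`, `x₂ ∈ evenFactorAlg V₂` (e.g. the point-ideal classes `aᵢ·1 + bᵢ·ωᵢ`, `ωᵢ` a top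
form of `Vᵢ`; `ch(I_p ⊠ I_q) = ch(I_p) ∧ ch(I_q)`), the MAIN THEOREM `span_sup_mul_eq`: the contraction span of `x₁ ∧ x₂`
with respect to `(L₁ ⊕ L₂, (L₁ ⊕ L₂)^⊥)` equals `S²(x₁)·(K x₂) + S¹(x₁)·S¹(x₂) + (K x₁)·S²(x₂)` (products of submodules of
`Λ V`; `S² = ContractionSpan.span`, `S¹ = ContractionSpan.span₁` of the factors) — th-7's
«`S(x) = S²(x₁) ⊗ x₂ ⊕ S¹(x₁) ⊗ S¹(x₂) ⊕ x₁ ⊗ S²(x₂)`» before counting. Ingredients: a form killing `L₁ ⊕ L₂` splits along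
`V = V₁ ⊕ V₂` as a sum of factor forms (`exists_factorForms_add`, Mathlib's `Submodule.projection`), bilinearity, and the
ten product rules of `ContractionSpanFactor.lean`. The COUNT (`dim = Σ_{i+j=2} rᵢ(x₁)·rⱼ(x₂)` from the linear disjointness
of `Λ V₁`, `Λ V₂` in `Λ V`) and the point-pair box `6n² - 2n` are the sequels.

References: [BourbakiAlgebre1a3] Ch. II §1 no. 8 (projectors of a direct sum), Ch. III §7 no. 7 and §11 no. 9;
[BuchweitzFlenner2008HH] Prop. 6.4.4.
-/

noncomputable section

open CliffordAlgebra (contractLeft)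
open ExteriorAlgebra (ι)
open Module

namespace Summit.Ventures.HSemireg

namespace ContractionSpan

section Ring

variable {K : Type*} [CommRing K] {V : Type*} [AddCommGroup V] [Module K V]

/-! ### 3. The product formula over a splitting `V = V₁ ⊕ V₂` -/

section Splitting

variable {V₁ V₂ L₁ L₂ : Submodule K V}

/-- A factor form kills `L₁ ⊕ L₂`. [cite: BourbakiAlgebre1a3, Ch. II §1] -/
theorem forall_sup_of_mem_factorForms_left (hL₂ : L₂ ≤ V₂) {θ : Module.Dual K V} (hθ : θ ∈ factorForms L₁ V₂) :
    ∀ q ∈ L₁ ⊔ L₂, θ q = 0 := by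
  intro q hq
  obtain ⟨q₁, hq₁, q₂, hq₂, rfl⟩ := Submodule.mem_sup.mp hq
  rw [map_add, hθ.1 q₁ hq₁, hθ.2 q₂ (hL₂ hq₂), add_zero]

/-- A factor form kills `L₁ ⊕ L₂` (second factor). [cite: BourbakiAlgebre1a3, Ch. II §1] -/
theorem forall_sup_of_mem_factorForms_right (hL₁ : L₁ ≤ V₁) {θ : Module.Dual K V} (hθ : θ ∈ factorForms L₂ V₁) :
    ∀ q ∈ L₁ ⊔ L₂, θ q = 0 := by
  intro q hq
  obtain ⟨q₁, hq₁, q₂, hq₂, rfl⟩ := Submodule.mem_sup.mp hq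
  rw [map_add, hθ.2 q₁ (hL₁ hq₁), hθ.1 q₂ hq₂, zero_add]

/-- **A form killing `L₁ ⊕ L₂` splits as a sum of factor forms** (`θ = θ ∘ pr₁ + θ ∘ pr₂` along `V = V₁ ⊕ V₂`).
[cite: BourbakiAlgebre1a3, Ch. II §1 no. 8] -/
theorem exists_factorForms_add (hV : IsCompl V₁ V₂) (hL₁ : L₁ ≤ V₁) (hL₂ : L₂ ≤ V₂) {θ : Module.Dual K V}
    (hθ : ∀ q ∈ L₁ ⊔ L₂, θ q = 0) :
    ∃ θ₁ ∈ factorForms L₁ V₂, ∃ θ₂ ∈ factorForms L₂ V₁, θ = θ₁ + θ₂ := by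
  refine ⟨θ ∘ₗ V₁.projection V₂ hV, ⟨fun q hq => ?_, fun v hv => ?_⟩,
    θ ∘ₗ V₂.projection V₁ hV.symm, ⟨fun q hq => ?_, fun v hv => ?_⟩, ?_⟩
  · rw [LinearMap.comp_apply, Submodule.projection_apply_left hV ⟨q, hL₁ hq⟩]
    exact hθ q (Submodule.mem_sup_left hq)
  · rw [LinearMap.comp_apply, Submodule.projection_apply_right hV ⟨v, hv⟩, map_zero]
  · rw [LinearMap.comp_apply, Submodule.projection_apply_left hV.symm ⟨q, hL₂ hq⟩]
    exact hθ q (Submodule.mem_sup_right hq)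
  · rw [LinearMap.comp_apply, Submodule.projection_apply_right hV.symm ⟨v, hv⟩, map_zero]
  · ext v
    rw [LinearMap.add_apply, LinearMap.comp_apply, LinearMap.comp_apply, ← map_add,
      Submodule.projection_add_projection_eq_self]

variable {x₁ x₂ : ExteriorAlgebra K V}

/-- **THEOREM (K_lin, degree ≤ 2, structure form; th-7 FORMULA-N §N.3 in the literal contraction frame).**
Over a splitting `V = V₁ ⊕ V₂` with `Lᵢ ⊆ Vᵢ`, for EVEN factor classes `x₁ ∈ Λ^{even} V₁`, `x₂ ∈ Λ^{even} V₂` the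
polyvector contraction span of the product class `x₁ ∧ x₂` with respect to `L₁ ⊕ L₂` and the forms killing it is
`S²(x₁)·(K x₂) + S¹(x₁)·S¹(x₂) + (K x₁)·S²(x₂)`, the factor spans being taken with respect to `(Lᵢ, factorForms Lᵢ V_{3-i})`.
[cite: BourbakiAlgebre1a3, Ch. III §7 no. 7 and §11 no. 9] -/
theorem span_sup_mul_eq (hV : IsCompl V₁ V₂) (hL₁ : L₁ ≤ V₁) (hL₂ : L₂ ≤ V₂) (hx₁ : x₁ ∈ evenFactorAlg V₁)
    (hx₂ : x₂ ∈ evenFactorAlg V₂) :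
    span ((L₁ ⊔ L₂ : Submodule K V) : Set V) {θ : Module.Dual K V | ∀ q ∈ L₁ ⊔ L₂, θ q = 0} (x₁ * x₂) =
      span (L₁ : Set V) (factorForms L₁ V₂) x₁ * (K ∙ x₂) ⊔
        span₁ (L₁ : Set V) (factorForms L₁ V₂) x₁ * span₁ (L₂ : Set V) (factorForms L₂ V₁) x₂ ⊔
        (K ∙ x₁) * span (L₂ : Set V) (factorForms L₂ V₁) x₂ := by
  -- shorthand for the membership of products in the three pieces
  have m₂₀ : ∀ {m}, m ∈ span (L₁ : Set V) (factorForms L₁ V₂) x₁ → m * x₂ ∈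
      span (L₁ : Set V) (factorForms L₁ V₂) x₁ * (K ∙ x₂) ⊔
        span₁ (L₁ : Set V) (factorForms L₁ V₂) x₁ * span₁ (L₂ : Set V) (factorForms L₂ V₁) x₂ ⊔
        (K ∙ x₁) * span (L₂ : Set V) (factorForms L₂ V₁) x₂ := fun hm =>
    Submodule.mem_sup_left (Submodule.mem_sup_left
      (Submodule.mul_mem_mul hm (Submodule.mem_span_singleton_self x₂)))
  have m₁₁ : ∀ {m n}, m ∈ span₁ (L₁ : Set V) (factorForms L₁ V₂) x₁ → n ∈ span₁ (L₂ : Set V) (factorForms L₂ V₁) x₂ →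
      m * n ∈ span (L₁ : Set V) (factorForms L₁ V₂) x₁ * (K ∙ x₂) ⊔
        span₁ (L₁ : Set V) (factorForms L₁ V₂) x₁ * span₁ (L₂ : Set V) (factorForms L₂ V₁) x₂ ⊔
        (K ∙ x₁) * span (L₂ : Set V) (factorForms L₂ V₁) x₂ := fun hm hn =>
    Submodule.mem_sup_left (Submodule.mem_sup_right (Submodule.mul_mem_mul hm hn))
  have m₀₂ : ∀ {n}, n ∈ span (L₂ : Set V) (factorForms L₂ V₁) x₂ → x₁ * n ∈
      span (L₁ : Set V) (factorForms L₁ V₂) x₁ * (K ∙ x₂) ⊔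
        span₁ (L₁ : Set V) (factorForms L₁ V₂) x₁ * span₁ (L₂ : Set V) (factorForms L₂ V₁) x₂ ⊔
        (K ∙ x₁) * span (L₂ : Set V) (factorForms L₂ V₁) x₂ := fun hn =>
    Submodule.mem_sup_right (Submodule.mul_mem_mul (Submodule.mem_span_singleton_self x₁) hn)
  apply le_antisymm
  · refine Submodule.span_le.mpr ?_
    rintro y ((⟨q, hq, q', hq', rfl⟩ | ⟨q, hq, θ, hθ, rfl⟩) | ⟨θ, hθ, θ', hθ', rfl⟩)
    · obtain ⟨q₁, hq₁, q₂, hq₂, rfl⟩ := Submodule.mem_sup.mp hq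
      obtain ⟨q₁', hq₁', q₂', hq₂', rfl⟩ := Submodule.mem_sup.mp hq'
      have key : ι K (q₁ + q₂) * (ι K (q₁' + q₂') * (x₁ * x₂)) =
          ι K q₁ * (ι K q₁' * x₁) * x₂ + ι K q₁ * x₁ * (ι K q₂' * x₂) +
            -(ι K q₁' * x₁ * (ι K q₂ * x₂)) + x₁ * (ι K q₂ * (ι K q₂' * x₂)) := by
        rw [wedge₂_mul, wedge₁_mul_wedge₁ hx₁, wedge₁_mul_wedge₁ hx₁, mul_wedge₂ hx₁, ← ι_mul_ι_mul_eq_neg q₂ q₁']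
        simp only [map_add, add_mul, mul_add]
        abel
      rw [key]
      exact Submodule.add_mem _ (Submodule.add_mem _ (Submodule.add_mem _
        (m₂₀ (Submodule.subset_span (Or.inl (Or.inl ⟨q₁, hq₁, q₁', hq₁', rfl⟩))))
        (m₁₁ (Submodule.subset_span (Or.inl ⟨q₁, hq₁, rfl⟩)) (Submodule.subset_span (Or.inl ⟨q₂', hq₂', rfl⟩))))
        (Submodule.neg_mem _ (m₁₁ (Submodule.subset_span (Or.inl ⟨q₁', hq₁', rfl⟩))
          (Submodule.subset_span (Or.inl ⟨q₂, hq₂, rfl⟩)))))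
        (m₀₂ (Submodule.subset_span (Or.inl (Or.inl ⟨q₂, hq₂, q₂', hq₂', rfl⟩))))
    · obtain ⟨q₁, hq₁, q₂, hq₂, rfl⟩ := Submodule.mem_sup.mp hq
      obtain ⟨θ₁, hθ₁, θ₂, hθ₂, rfl⟩ := exists_factorForms_add hV hL₁ hL₂ hθ
      have key : ι K (q₁ + q₂) * contractLeft (θ₁ + θ₂) (x₁ * x₂) =
          ι K q₁ * contractLeft θ₁ x₁ * x₂ + ι K q₁ * x₁ * contractLeft θ₂ x₂ +
            -(contractLeft θ₁ x₁ * (ι K q₂ * x₂)) + x₁ * (ι K q₂ * contractLeft θ₂ x₂) := by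
        rw [mixed_mul hx₁ hx₂ q₁ hθ₁.2, wedge₁_mul_contract₁ hx₁ q₁ hθ₂.2, contract₁_mul_wedge₁ hx₁ hx₂ hθ₁.2 q₂,
          neg_neg, mul_mixed hx₁ q₂ hθ₂.2]
        simp only [map_add, LinearMap.add_apply, add_mul, mul_add]
        abel
      rw [key]
      exact Submodule.add_mem _ (Submodule.add_mem _ (Submodule.add_mem _
        (m₂₀ (Submodule.subset_span (Or.inl (Or.inr ⟨q₁, hq₁, θ₁, hθ₁, rfl⟩))))
        (m₁₁ (Submodule.subset_span (Or.inl ⟨q₁, hq₁, rfl⟩)) (Submodule.subset_span (Or.inr ⟨θ₂, hθ₂, rfl⟩))))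
        (Submodule.neg_mem _ (m₁₁ (Submodule.subset_span (Or.inr ⟨θ₁, hθ₁, rfl⟩))
          (Submodule.subset_span (Or.inl ⟨q₂, hq₂, rfl⟩)))))
        (m₀₂ (Submodule.subset_span (Or.inl (Or.inr ⟨q₂, hq₂, θ₂, hθ₂, rfl⟩))))
    · obtain ⟨θ₁, hθ₁, θ₂, hθ₂, rfl⟩ := exists_factorForms_add hV hL₁ hL₂ hθ
      obtain ⟨θ₁', hθ₁', θ₂', hθ₂', rfl⟩ := exists_factorForms_add hV hL₁ hL₂ hθ'
      have key : contractLeft (θ₁ + θ₂) (contractLeft (θ₁' + θ₂') (x₁ * x₂)) =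
          contractLeft θ₁ (contractLeft θ₁' x₁) * x₂ + contractLeft θ₁ x₁ * contractLeft θ₂' x₂ +
            -(contractLeft θ₁' x₁ * contractLeft θ₂ x₂) + x₁ * contractLeft θ₂ (contractLeft θ₂' x₂) := by
        rw [contract₂_mul hx₁ hx₂ hθ₁.2 hθ₁'.2, contract₁_mul_contract₁ hx₁ hx₂ hθ₁.2 hθ₂'.2,
          contract₁_mul_contract₁ hx₁ hx₂ hθ₁'.2 hθ₂.2, mul_contract₂ hx₁ hθ₂.2 hθ₂'.2,
          ← CliffordAlgebra.contractLeft_comm θ₂ θ₁']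
        simp only [map_add, LinearMap.add_apply]
        abel
      rw [key]
      exact Submodule.add_mem _ (Submodule.add_mem _ (Submodule.add_mem _
        (m₂₀ (Submodule.subset_span (Or.inr ⟨θ₁, hθ₁, θ₁', hθ₁', rfl⟩)))
        (m₁₁ (Submodule.subset_span (Or.inr ⟨θ₁, hθ₁, rfl⟩)) (Submodule.subset_span (Or.inr ⟨θ₂', hθ₂', rfl⟩))))
        (Submodule.neg_mem _ (m₁₁ (Submodule.subset_span (Or.inr ⟨θ₁', hθ₁', rfl⟩))
          (Submodule.subset_span (Or.inr ⟨θ₂, hθ₂, rfl⟩)))))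
        (m₀₂ (Submodule.subset_span (Or.inr ⟨θ₂, hθ₂, θ₂', hθ₂', rfl⟩)))
  · refine sup_le (sup_le ?_ ?_) ?_
    · rw [span, Submodule.span_mul_span]
      refine Submodule.span_le.mpr ?_
      rintro y ⟨m, hm, n, hn, rfl⟩
      rw [Set.mem_singleton_iff] at hn
      dsimp only
      rw [hn]
      rcases hm with ((⟨q, hq, q', hq', rfl⟩ | ⟨q, hq, θ, hθ, rfl⟩) | ⟨θ, hθ, θ', hθ', rfl⟩)
      · rw [wedge₂_mul]
        exact Submodule.subset_span (Or.inl (Or.inl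
          ⟨q, Submodule.mem_sup_left hq, q', Submodule.mem_sup_left hq', rfl⟩))
      · rw [mixed_mul hx₁ hx₂ q hθ.2]
        exact Submodule.subset_span (Or.inl (Or.inr
          ⟨q, Submodule.mem_sup_left hq, θ, forall_sup_of_mem_factorForms_left hL₂ hθ, rfl⟩))
      · rw [contract₂_mul hx₁ hx₂ hθ.2 hθ'.2]
        exact Submodule.subset_span (Or.inr ⟨θ, forall_sup_of_mem_factorForms_left hL₂ hθ, θ',
          forall_sup_of_mem_factorForms_left hL₂ hθ', rfl⟩)
    · rw [span₁, span₁, Submodule.span_mul_span]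
      refine Submodule.span_le.mpr ?_
      rintro y ⟨m, hm, n, hn, rfl⟩
      dsimp only
      rcases hm with (⟨q₁, hq₁, rfl⟩ | ⟨θ₁, hθ₁, rfl⟩) <;> rcases hn with (⟨q₂, hq₂, rfl⟩ | ⟨θ₂, hθ₂, rfl⟩)
      · rw [wedge₁_mul_wedge₁ hx₁]
        exact Submodule.subset_span (Or.inl (Or.inl
          ⟨q₁, Submodule.mem_sup_left hq₁, q₂, Submodule.mem_sup_right hq₂, rfl⟩))
      · rw [wedge₁_mul_contract₁ hx₁ q₁ hθ₂.2]
        exact Submodule.subset_span (Or.inl (Or.inr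
          ⟨q₁, Submodule.mem_sup_left hq₁, θ₂, forall_sup_of_mem_factorForms_right hL₁ hθ₂, rfl⟩))
      · rw [contract₁_mul_wedge₁ hx₁ hx₂ hθ₁.2 q₂]
        exact Submodule.neg_mem _ (Submodule.subset_span (Or.inl (Or.inr
          ⟨q₂, Submodule.mem_sup_right hq₂, θ₁, forall_sup_of_mem_factorForms_left hL₂ hθ₁, rfl⟩)))
      · rw [contract₁_mul_contract₁ hx₁ hx₂ hθ₁.2 hθ₂.2]
        exact Submodule.subset_span (Or.inr ⟨θ₁, forall_sup_of_mem_factorForms_left hL₂ hθ₁, θ₂,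
          forall_sup_of_mem_factorForms_right hL₁ hθ₂, rfl⟩)
    · rw [span, Submodule.span_mul_span]
      refine Submodule.span_le.mpr ?_
      rintro y ⟨m, hm, n, hn, rfl⟩
      rw [Set.mem_singleton_iff] at hm
      dsimp only
      rw [hm]
      rcases hn with ((⟨q, hq, q', hq', rfl⟩ | ⟨q, hq, θ, hθ, rfl⟩) | ⟨θ, hθ, θ', hθ', rfl⟩)
      · rw [mul_wedge₂ hx₁]
        exact Submodule.subset_span (Or.inl (Or.inl
          ⟨q, Submodule.mem_sup_right hq, q', Submodule.mem_sup_right hq', rfl⟩))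
      · rw [mul_mixed hx₁ q hθ.2]
        exact Submodule.subset_span (Or.inl (Or.inr
          ⟨q, Submodule.mem_sup_right hq, θ, forall_sup_of_mem_factorForms_right hL₁ hθ, rfl⟩))
      · rw [mul_contract₂ hx₁ hθ.2 hθ'.2]
        exact Submodule.subset_span (Or.inr ⟨θ, forall_sup_of_mem_factorForms_right hL₁ hθ, θ',
          forall_sup_of_mem_factorForms_right hL₁ hθ', rfl⟩)

end Splitting

end Ring

end ContractionSpan

end Summit.Ventures.HSemireg

end
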